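import Summits.QuantumFields.YangMills.Theorems.FluctuationComparisonRegPrIntLS2BetaWhitneyHatLiftCurvatureSecondOrderGlobal
import Summits.QuantumFields.YangMills.Theorems.FluctuationComparisonRegPrIntLS2BetaSU2FourFactorRelative
import HarnessLib

/-!
# S2β · (L♭) road, way-out (a) «kinematic» — D6: THE ALL-ORDERS REFINED (F3) LETTER VIA THE EXACT `SU(2)` COMMUTATOR IDENTITY
# `e^{ιa}e^{ιd} − e^{ιd}e^{ιa} = sinc‖a‖·sinc‖d‖·[ιa, ιd]`:  `dist1 (V(∂p)) ≤ (L⁻¹)²·((π²∕4)(F + 2Δ) + 2Δ + 8σΔ)` for arcs `≤ π∕2` —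
# NO pure-size term at ANY order, NO `1∕4` chart guard (px21 g23 ■ FINAL «RECOMMENDED NEXT», its Census «What is missing»)

Cell `ym3-torus` (rung R3 = continuum `SU(2)` Yang–Mills on the three-torus — NOT d = 4, NOT infinite volume, NOT a mass gap, NOT Clay).
Width seat «width 12» `ym3-torus-px12` (gen 25), FREE px helper on crux `stmt-QuantumFields-20520` (`Theses.UnitScaleTilt.FluctuationComparisonRegPrIntL`);
`--kind proof --supports stmt-QuantumFields-20520 --as helper`, count-neutral, DEFINITION-FREE (0 `def`, 0 `instance`, 0 `notation`, 0 `sorry`, default heartbeats;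
weights `w`, lift `V` pinned by px12 g23's formulas `hw`∕`hV` exactly as in ✓p827372 `…WhitneyHatLiftCurvatureSecondOrder` (D2) and ✓p827730 `…Global` (D4)).

WHY (px21 g23 ■ FINAL 16:14:53Z + `g23/NOTES-px21g23.md` Census; UV3-NODE §91∕§84.9).  D2's refined letter `(L⁻¹)²·(F + (F + 12σ²)² + 20σΔ + 2Δ² + 35σ³)` still carries
PURE-SIZE terms `144σ⁴ + 35σ³` (BCH truncation) and the chart guard `σ ≤ 1∕4`, which put the smallest top geometry `(m,J) = (1,0)` (Polyakov floor `π∕10 > 1∕4`) out of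
reach of the (a)-road (§91.4).  Both are artefacts.  In `ℍ`, `e^{ιx} = cos‖x‖ + sinc‖x‖·ιx` (lit ✓`exp_imQuat`), so EXACTLY
`e^{ιa}e^{ιd} − e^{ιd}e^{ιa} = sinc‖a‖·sinc‖d‖·(ιa·ιd − ιd·ιa)` (the `cos` parts are central); with the unitary telescoping
`dist1((e^a e^d e^{−a} e^{−d})⁻¹·(e^a e^b e^{−c} e^{−d})) ≤ ‖b − d‖ + ‖c − a‖` (✓`dist1_plaq4_rel_le_sum`, hypothesis-free) this gives, for ANY four vectors,
`dist1 (e^a e^b e^{−c} e^{−d}) ≤ ‖b − d‖ + ‖c − a‖ + ‖[ιa, ιd]‖` (`|sinc| ≤ 1`), and conversely, by Jordan (`sinc ≥ 2∕π` on `[0, π∕2]`, Mathlib `Real.mul_le_sin`),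
`‖[ιa, ιd]‖ ≤ (π∕2)²·(dist1 (e^a e^b e^{−c} e^{−d}) + ‖b − d‖ + ‖c − a‖)` for `‖a‖, ‖d‖ ≤ π∕2`.  Applied to the hat lift (fine step: the first; coarse step: the second on
one column plaquette, whose base commutator is within `4σΔ` of the reference commutator `[ιRμ, ιRν]`, itself within `4σΔ·L²∕L²` of the fine one — D2 §1∕§2's
convexity letters VERBATIM): `dist1 (V(∂p)) ≤ (L⁻¹)²·((π²∕4)(F + 2Δ) + 2Δ + 8σΔ)`.  Every term carries `F` or `Δ`; torons (`Δ = 0`, `F = 0`) give `0` exactly as they must.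
* §1 ★★`exp_imQuat_comm_eq` (the identity), ★`norm_exp_comm_le_norm_comm` (`|sinc| ≤ 1`), ★`norm_comm_le_sq_mul_norm_exp_comm` (arcs `≤ π∕2`, Jordan inline),
  `dist1_commWord_eq` (`dist1 (e^a e^d (e^a)⁻¹ (e^d)⁻¹) = ‖e^{ιa}e^{ιd} − e^{ιd}e^{ιa}‖`).
* §2 ★★`dist1_plaq4_le_var_add_comm` (NO hypotheses) and ★★`norm_comm_le_of_plaq4` (arcs `≤ π∕2`) — the two directions, for four-factor words of exponentials;
  `norm_comm_logVec_le_of_plaqHol` (the coarse-plaquette reading in `logVec` currency).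
* §3 ★★★`dist1_plaqHol_lift_le_allOrders` — THE LETTER, local form, hypotheses shaped EXACTLY like ✓p827372 `dist1_plaqHol_lift_le_second`'s with `hσ4 : σ ≤ 1∕4` replaced by
  `hσ2 : σ ≤ π∕2`:  `dist1 (V(∂p)) ≤ (L⁻¹)²·(π²∕4·(F + 2Δ) + 2Δ + 8σΔ)`.
* §4 ★★★`dist1_plaqHol_lift_le_allOrders_of_forall` — the GLOBAL two-profile docking form at `d = 3` (✓p827730's support geometry VERBATIM, `Δ = 2v`):
  `dist1 (V(∂p)) ≤ (L⁻¹)²·(π²∕4·(F + 4v) + 4v + 16sv)` from `‖log X‖ ≤ s ≤ π∕2`, chords `≤ F`, adjacent transverse parallel variations `≤ v` — the drop-in replacement of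
  ✓`dist1_plaqHol_lift_le_second_of_forall` in ✓p828064 `arc_le_sup_step_hatLift_var` (D5): NO `s²`, NO `s³`, NO `s⁴`, NO `s ≤ 1∕4`.

WHERE IT SITS (honest; UV3-NODE §84.9): D6 serves the SMALL-`N_J` end of the small-bond conjunct of the (D-stage) guard (after it the START question of the (L♭) sup
profile is the `v`-STEP contraction number only, px21 §91); it does NOT touch the large-`N_J` end (§84.9 (3)–(4)).  Zero-regret kinematics: any road comparing hat lifts wants it.

HONEST SCOPE.  `ℍ` algebra, Jordan's inequality, finite sums and D2∕D4's convexity∕support letters by name; every constant explicit; nothing of Bałaban's analysis is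
asserted or proved ([Balaban1985RegularSpaces] (1.29) p.81 — size AND derivative bounds of the small fields in the regular spaces — is the printed locus this kinematics
serves; the hat lift is px12 g23's construction after [Balaban1984PropagatorsI] (1.7) p.18; [Balaban1985Variational] (34) p.283 the plaquette expansion it replaces by an
identity); the `(s, v)` recursion's `v`-step, (L♭) along the towers, (D-ax), GAP♯∘ (`stub_uniformFibreGapOrbit`, registry 3732b7df UNTOUCHED), S2β, crux 20520 and
`YM3TorusSU2` are NOT proved; no registered stub is closed; rung R3 = SU(2) YM₃ on T³ — NOT d = 4, NOT infinite volume, NOT a mass gap, NOT Clay; the Yang–Mills mass gap is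
NOT proved.  References: T. Bałaban, CMP **99** (1985) 75–102 [Balaban1985RegularSpaces]; CMP **102** (1985) 277–309 [Balaban1985Variational]; CMP **95** (1984) 17–40
[Balaban1984PropagatorsI].
-/

set_option autoImplicit false

namespace Summit.QuantumFields.YangMills.Theorems.FluctuationComparisonRegPrIntLS2BetaWhitneyHatLiftCurvatureAllOrders

open Finset
open scoped Real Quaternion
open NormedSpace
open Literature.MathematicalPhysics.QuantumLattice (su2Quat norm_su2Quat)
open Literature.MathematicalPhysics.QuantumFieldTheory.Balaban1983to89
open B10Eq27TorusAxialLog (rel rel_apply)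
open T4CubeChartGnomonic (SU2)
open T4HaarSU2ExpChart (imQuat norm_imQuat exp_imQuat expPoint su2Quat_expPoint)
open T4HaarSU2Translate (su2Quat_mul su2Quat_one)
open T4ExpWindowSmallField (logVec expPoint_logVec dist1_eq_norm_su2Quat_sub_one)
open Summit.QuantumFields.YangMills.Theorems.FluctuationComparisonRegPrIntLS2BetaWhitneyHatWeights (sum_hatW_eq_one hatW_nonneg emb_apply hatW_support)
open Summit.QuantumFields.YangMills.Theorems.FluctuationComparisonRegPrIntLS2BetaWhitneyHatCurl
  (sub_shift_hat_eq colW_nonneg sum_colW_eq_one shift_apply_self shift_apply_ne colW_support)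
open Summit.QuantumFields.YangMills.Theorems.FluctuationComparisonRegPrIntLS2BetaWhitneyHatLiftCurvature (norm_hatSum_le_of_support)
open Summit.QuantumFields.YangMills.Theorems.FluctuationComparisonRegPrIntLS2BetaWhitneyHatLiftCurvatureSecondOrder
  (colW_swap norm_hatSum_sub_le_of_support norm_sub_shift_hat_le norm_comm_sub_comm_ref_le)
open Summit.QuantumFields.YangMills.Theorems.FluctuationComparisonRegPrIntLS2BetaWhitneyHatLiftCurvatureSecondOrderGlobal
  (coord_eq_of_rel_slab coord_near_of_rel_lt norm_sub_le_two_mul_of_near)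
open Summit.QuantumFields.YangMills.Theorems.FluctuationComparisonRegPrIntLS2BetaSU2FourFactorRelative (dist1_plaq4_rel_le_sum)
open Summit.QuantumFields.YangMills.Theorems.SU2NearCommuting (dist1_mul_inv_eq_norm_sub)

variable {P : Params} {t : ℕ}

/-! ## §1 The exact commutator of two exponentials in `ℍ` -/

/-- ★★ **THE EXACT COMMUTATOR IDENTITY**: `e^{ιa}e^{ιd} − e^{ιd}e^{ιa} = (sinc‖a‖·sinc‖d‖)·(ιa·ιd − ιd·ιa)` — from `e^{ιx} = cos‖x‖ + sinc‖x‖·ιx` (lit ✓`exp_imQuat`);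
the real parts are central. [folklore] -/
theorem exp_imQuat_comm_eq (a d : EuclideanSpace ℝ (Fin 3)) :
    exp (imQuat a) * exp (imQuat d) - exp (imQuat d) * exp (imQuat a)
      = (Real.sinc ‖a‖ * Real.sinc ‖d‖) • (imQuat a * imQuat d - imQuat d * imQuat a) := by
  rw [exp_imQuat, exp_imQuat]
  simp only [add_mul, mul_add, Quaternion.coe_mul_eq_smul, Quaternion.mul_coe_eq_smul, smul_mul_assoc, mul_smul_comm,
    smul_smul, smul_sub, smul_add, Quaternion.smul_coe]
  rw [mul_comm (Real.cos ‖d‖) (Real.cos ‖a‖), mul_comm (Real.sinc ‖d‖) (Real.cos ‖a‖), mul_comm (Real.sinc ‖d‖) (Real.sinc ‖a‖),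
    mul_comm (Real.sinc ‖a‖) (Real.cos ‖d‖)]
  abel

/-- ★ `‖e^{ιa}e^{ιd} − e^{ιd}e^{ιa}‖ ≤ ‖ιa·ιd − ιd·ιa‖` (`|sinc| ≤ 1`) — NO hypothesis on the sizes. [folklore] -/
theorem norm_exp_comm_le_norm_comm (a d : EuclideanSpace ℝ (Fin 3)) :
    ‖exp (imQuat a) * exp (imQuat d) - exp (imQuat d) * exp (imQuat a)‖ ≤ ‖imQuat a * imQuat d - imQuat d * imQuat a‖ := by
  rw [exp_imQuat_comm_eq, norm_smul, Real.norm_eq_abs, abs_mul]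
  have h1 := Real.abs_sinc_le_one ‖a‖
  have h2 := Real.abs_sinc_le_one ‖d‖
  have h3 : |Real.sinc ‖a‖| * |Real.sinc ‖d‖| ≤ 1 := by nlinarith [abs_nonneg (Real.sinc ‖a‖), abs_nonneg (Real.sinc ‖d‖)]
  exact mul_le_of_le_one_left (norm_nonneg _) h3

/-- ★ **THE CONVERSE FOR ARCS `≤ π∕2`**: `‖ιa·ιd − ιd·ιa‖ ≤ (π∕2)²·‖e^{ιa}e^{ιd} − e^{ιd}e^{ιa}‖` (Jordan twice). [folklore] -/
theorem norm_comm_le_sq_mul_norm_exp_comm (a d : EuclideanSpace ℝ (Fin 3)) (ha : ‖a‖ ≤ π / 2) (hd : ‖d‖ ≤ π / 2) :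
    ‖imQuat a * imQuat d - imQuat d * imQuat a‖ ≤ (π / 2) ^ 2 * ‖exp (imQuat a) * exp (imQuat d) - exp (imQuat d) * exp (imQuat a)‖ := by
  rw [exp_imQuat_comm_eq, norm_smul, Real.norm_eq_abs, abs_mul]
  -- Jordan's inequality in `sinc` form: `2∕π ≤ sinc x` on `[0, π∕2]` (Mathlib `Real.mul_le_sin`; the tree's ✓`CoarseStiffnessTailCommutatorChart.two_div_pi_le_sinc`
  -- is the same fact in a module outside this import cone)
  have jordan : ∀ {x : ℝ}, 0 ≤ x → x ≤ π / 2 → 2 / π ≤ Real.sinc x := fun {x} h0 h => by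
    rcases eq_or_lt_of_le h0 with hx | hx
    · rw [← hx, Real.sinc_zero, div_le_one Real.pi_pos]
      linarith [Real.pi_gt_three]
    · rw [Real.sinc_of_ne_zero hx.ne', le_div_iff₀ hx]
      have := Real.mul_le_sin h0 h
      linarith
  have h1 : 2 / π ≤ Real.sinc ‖a‖ := jordan (norm_nonneg _) ha
  have h2 : 2 / π ≤ Real.sinc ‖d‖ := jordan (norm_nonneg _) hd
  have hπ : 0 < 2 / π := div_pos two_pos Real.pi_pos
  rw [abs_of_pos (hπ.trans_le h1), abs_of_pos (hπ.trans_le h2)]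
  have h12 : (2 / π) ^ 2 ≤ Real.sinc ‖a‖ * Real.sinc ‖d‖ := by rw [sq]; exact mul_le_mul h1 h2 hπ.le (hπ.trans_le h1).le
  have hC : (π / 2) ^ 2 * (2 / π) ^ 2 = 1 := by field_simp
  calc ‖imQuat a * imQuat d - imQuat d * imQuat a‖
      = ((π / 2) ^ 2 * (2 / π) ^ 2) * ‖imQuat a * imQuat d - imQuat d * imQuat a‖ := by rw [hC, one_mul]
    _ ≤ ((π / 2) ^ 2 * (Real.sinc ‖a‖ * Real.sinc ‖d‖)) * ‖imQuat a * imQuat d - imQuat d * imQuat a‖ := by gcongr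
    _ = _ := by ring

/-- `dist1 (e^a e^d (e^a)⁻¹ (e^d)⁻¹) = ‖e^{ιa}e^{ιd} − e^{ιd}e^{ιa}‖` (left∕right invariance of the chord on `SU(2)`). [folklore] -/
theorem dist1_commWord_eq (a d : EuclideanSpace ℝ (Fin 3)) :
    dist1 (expPoint a * expPoint d * (expPoint a)⁻¹ * (expPoint d)⁻¹) = ‖exp (imQuat a) * exp (imQuat d) - exp (imQuat d) * exp (imQuat a)‖ := by
  have e : expPoint a * expPoint d * (expPoint a)⁻¹ * (expPoint d)⁻¹ = (expPoint a * expPoint d) * (expPoint d * expPoint a)⁻¹ := by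
    rw [mul_inv_rev]; group
  rw [e, dist1_mul_inv_eq_norm_sub, su2Quat_mul, su2Quat_mul, su2Quat_expPoint, su2Quat_expPoint]

/-! ## §2 Four-factor words of exponentials: chord ⇆ variations + base commutator, EXACTLY -/

/-- ★★ **CHORD ≤ PARALLEL VARIATIONS + BASE COMMUTATOR, NO HYPOTHESES**: `dist1 (e^a e^b (e^c)⁻¹ (e^d)⁻¹) ≤ ‖b − d‖ + ‖c − a‖ + ‖ιa·ιd − ιd·ιa‖`
(reference word `e^a e^d (e^a)⁻¹ (e^d)⁻¹`, ✓`dist1_plaq4_rel_le_sum`, §1). [cite: Balaban1985Variational, (34) p.283] -/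
theorem dist1_plaq4_le_var_add_comm (a b c d : EuclideanSpace ℝ (Fin 3)) :
    dist1 (expPoint a * expPoint b * (expPoint c)⁻¹ * (expPoint d)⁻¹) ≤ ‖b - d‖ + ‖c - a‖ + ‖imQuat a * imQuat d - imQuat d * imQuat a‖ := by
  set X := expPoint a * expPoint b * (expPoint c)⁻¹ * (expPoint d)⁻¹ with hX
  set R := expPoint a * expPoint d * (expPoint a)⁻¹ * (expPoint d)⁻¹ with hR
  have h1 : dist1 (R⁻¹ * X) ≤ ‖a - a‖ + ‖b - d‖ + ‖c - a‖ + ‖d - d‖ := dist1_plaq4_rel_le_sum a b c d a d a d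
  rw [sub_self, sub_self, norm_zero, zero_add, add_zero] at h1
  have h2 : dist1 R ≤ ‖imQuat a * imQuat d - imQuat d * imQuat a‖ := by rw [hR, dist1_commWord_eq]; exact norm_exp_comm_le_norm_comm a d
  have h3 : dist1 X ≤ dist1 R + dist1 (R⁻¹ * X) := by
    have := GaugeGroup.dist1_mul_le R (R⁻¹ * X); rwa [mul_inv_cancel_left] at this
  linarith

/-- ★★ **BASE COMMUTATOR ≤ (π∕2)²·(CHORD + PARALLEL VARIATIONS)** for `‖a‖, ‖d‖ ≤ π∕2`: a small plaquette with small parallel variations forces its two DIRECTIONS to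
nearly commute — at all orders, no BCH truncation. [cite: Balaban1985Variational, (34) p.283] -/
theorem norm_comm_le_of_plaq4 (a b c d : EuclideanSpace ℝ (Fin 3)) (ha : ‖a‖ ≤ π / 2) (hd : ‖d‖ ≤ π / 2) :
    ‖imQuat a * imQuat d - imQuat d * imQuat a‖ ≤ (π / 2) ^ 2 * (dist1 (expPoint a * expPoint b * (expPoint c)⁻¹ * (expPoint d)⁻¹) + ‖b - d‖ + ‖c - a‖) := by
  set X := expPoint a * expPoint b * (expPoint c)⁻¹ * (expPoint d)⁻¹ with hX
  set R := expPoint a * expPoint d * (expPoint a)⁻¹ * (expPoint d)⁻¹ with hR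
  have h1 : dist1 (R⁻¹ * X) ≤ ‖a - a‖ + ‖b - d‖ + ‖c - a‖ + ‖d - d‖ := dist1_plaq4_rel_le_sum a b c d a d a d
  rw [sub_self, sub_self, norm_zero, zero_add, add_zero] at h1
  have h3 : dist1 R ≤ dist1 X + dist1 (R⁻¹ * X) := by
    have := GaugeGroup.dist1_mul_le X (R⁻¹ * X)⁻¹
    rw [GaugeGroup.dist1_inv] at this
    have e : X * (R⁻¹ * X)⁻¹ = R := by group
    rwa [e] at this
  have h4 := norm_comm_le_sq_mul_norm_exp_comm a d ha hd
  rw [← dist1_commWord_eq, ← hR] at h4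
  calc _ ≤ (π / 2) ^ 2 * dist1 R := h4
    _ ≤ (π / 2) ^ 2 * (dist1 X + ‖b - d‖ + ‖c - a‖) := by gcongr; linarith

/-- The coarse-plaquette reading: for `X₁ X₂ X₃⁻¹ X₄⁻¹` with `‖log X₁‖, ‖log X₄‖ ≤ π∕2`,
`‖[ι log X₁, ι log X₄]‖ ≤ (π∕2)²·(dist1 (X₁X₂X₃⁻¹X₄⁻¹) + ‖log X₂ − log X₄‖ + ‖log X₃ − log X₁‖)`. [cite: Balaban1985Variational, (34) p.283] -/
theorem norm_comm_logVec_le_of_plaqHol (X₁ X₂ X₃ X₄ : SU2) (h₁ : ‖logVec (su2Quat X₁)‖ ≤ π / 2) (h₄ : ‖logVec (su2Quat X₄)‖ ≤ π / 2) :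
    ‖imQuat (logVec (su2Quat X₁)) * imQuat (logVec (su2Quat X₄)) - imQuat (logVec (su2Quat X₄)) * imQuat (logVec (su2Quat X₁))‖
      ≤ (π / 2) ^ 2 * (dist1 (X₁ * X₂ * X₃⁻¹ * X₄⁻¹) + ‖logVec (su2Quat X₂) - logVec (su2Quat X₄)‖ + ‖logVec (su2Quat X₃) - logVec (su2Quat X₁)‖) := by
  have h := norm_comm_le_of_plaq4 (logVec (su2Quat X₁)) (logVec (su2Quat X₂)) (logVec (su2Quat X₃)) (logVec (su2Quat X₄)) h₁ h₄
  rwa [expPoint_logVec, expPoint_logVec, expPoint_logVec, expPoint_logVec] at h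

/-! ## §3 The all-orders refined (F3) letter, local form -/

/-- ★★★ **THE CURVATURE OF THE HAT LIFT, ALL ORDERS (refined (F3), local form)**.  Standing range; `X` the coarse field, `V` its hat lift (px12's `hw`∕`hV`),
`p = (x; μ < ν)` a fine plaquette.  Hypotheses EXACTLY as ✓p827372 `dist1_plaqHol_lift_le_second`'s (`hσb`, `hΔμ`, `hΔν`, `hσy`: sizes `≤ σ` on the supports, two reference
vectors `Rμ, Rν` with `‖Rμ‖ ≤ σ` within `Δ` of the feeding logs, column plaquettes with chord `≤ F`, reference deviations and parallel variations `≤ Δ`) with the chart guard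
`σ ≤ 1∕4` REPLACED by `σ ≤ π∕2`.  Then
    `dist1 (V(∂p)) ≤ (L⁻¹)² · (π²∕4·(F + 2Δ) + 2Δ + 8σΔ)`
— fine step §2 `dist1_plaq4_le_var_add_comm` (two fine variations `L⁻²Δ` each by ✓`norm_sub_shift_hat_le`; fine commutator within `4·(L⁻¹σ)(L⁻¹Δ)` of `L⁻²[ιRμ, ιRν]`
by ✓`norm_comm_sub_comm_ref_le`); coarse step on ONE column plaquette: `[ιRμ, ιRν]` within `4σΔ` of its base commutator, which is `≤ π²∕4·(F + 2Δ)` by §2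
`norm_comm_logVec_le_of_plaqHol`.  NO pure-size term at any order. [cite: Balaban1985RegularSpaces, (1.29) p.81] -/
theorem dist1_plaqHol_lift_le_allOrders (ht : t + 1 ≤ P.m + P.K) (w : PBond P t → PBond P (t + 1) → ℝ)
    (hw : ∀ b e, w b e = if e.dir = b.dir ∧ (b.src b.dir - emb e.src b.dir).val < P.L then
      ∏ ν ∈ Finset.univ.erase b.dir, max 0 (1 - ((rel (emb e.src) b.src ν).natAbs : ℝ) / P.L) else 0)
    (X : GaugeField P (t + 1) SU2) (V : GaugeField P t SU2)
    (hV : ∀ b, V b = expPoint (∑ e, w b e • ((P.L : ℝ)⁻¹ • logVec (su2Quat (X e))))) (p : Plaq P t)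
    {σ F Δ : ℝ} (Rμ Rν : EuclideanSpace ℝ (Fin 3)) (hσ2 : σ ≤ π / 2) (hRμ : ‖Rμ‖ ≤ σ)
    (hσb : ∀ e, (w ⟨p.src, p.μ⟩ e ≠ 0 ∨ w ⟨p.src.shift p.μ, p.ν⟩ e ≠ 0 ∨ w ⟨p.src.shift p.ν, p.μ⟩ e ≠ 0 ∨ w ⟨p.src, p.ν⟩ e ≠ 0) →
      ‖logVec (su2Quat (X e))‖ ≤ σ)
    (hΔμ : ∀ e, w ⟨p.src, p.μ⟩ e ≠ 0 → ‖logVec (su2Quat (X e)) - Rμ‖ ≤ Δ)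
    (hΔν : ∀ e, w ⟨p.src, p.ν⟩ e ≠ 0 → ‖logVec (su2Quat (X e)) - Rν‖ ≤ Δ)
    (hσy : ∀ y : Site P (t + 1), (if (p.src p.μ - emb y p.μ).val < P.L then (1 : ℝ) else 0) *
          (∏ κ ∈ (Finset.univ.erase p.μ).erase p.ν, max 0 (1 - ((rel (emb y) p.src κ).natAbs : ℝ) / P.L)) *
          (if (p.src p.ν - emb y p.ν).val < P.L then (1 : ℝ) else 0) ≠ 0 →
      ‖logVec (su2Quat (X ⟨y, p.μ⟩))‖ ≤ σ ∧ ‖logVec (su2Quat (X ⟨y.shift p.μ, p.ν⟩))‖ ≤ σ ∧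
        ‖logVec (su2Quat (X ⟨y.shift p.ν, p.μ⟩))‖ ≤ σ ∧ ‖logVec (su2Quat (X ⟨y, p.ν⟩))‖ ≤ σ ∧
        dist1 (GaugeField.plaqHol X ⟨y, p.μ, p.ν, p.hμν⟩) ≤ F ∧
        ‖logVec (su2Quat (X ⟨y, p.μ⟩)) - Rμ‖ ≤ Δ ∧ ‖logVec (su2Quat (X ⟨y, p.ν⟩)) - Rν‖ ≤ Δ ∧
        ‖logVec (su2Quat (X ⟨y.shift p.ν, p.μ⟩)) - logVec (su2Quat (X ⟨y, p.μ⟩))‖ ≤ Δ ∧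
        ‖logVec (su2Quat (X ⟨y.shift p.μ, p.ν⟩)) - logVec (su2Quat (X ⟨y, p.ν⟩))‖ ≤ Δ) :
    dist1 (GaugeField.plaqHol V p) ≤ ((P.L : ℝ)⁻¹) ^ 2 * (π ^ 2 / 4 * (F + 2 * Δ) + 2 * Δ + 8 * σ * Δ) := by
  have hL1 : (1 : ℝ) ≤ P.L := by exact_mod_cast P.L_pos
  set u : ℝ := (P.L : ℝ)⁻¹ with hu
  have hu0 : 0 ≤ u := inv_nonneg.mpr (Nat.cast_nonneg _)
  -- the exponents of the lift
  set A : PBond P (t + 1) → EuclideanSpace ℝ (Fin 3) := fun e => u • logVec (su2Quat (X e)) with hA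
  set a : PBond P t → EuclideanSpace ℝ (Fin 3) := fun b => ∑ e, w b e • A e with ha
  have hVa : ∀ b, V b = expPoint (a b) := fun b => by rw [hV]
  have hAσ : ∀ e, ‖logVec (su2Quat (X e))‖ ≤ σ → ‖A e‖ ≤ u * σ := fun e he => by
    rw [hA]; dsimp only; rw [norm_smul, Real.norm_eq_abs, abs_of_nonneg hu0]
    exact mul_le_mul_of_nonneg_left he hu0
  have hAΔ : ∀ e R, ‖logVec (su2Quat (X e)) - R‖ ≤ Δ → ‖A e - u • R‖ ≤ u * Δ := fun e R he => by
    rw [hA]; dsimp only; rw [← smul_sub, norm_smul, Real.norm_eq_abs, abs_of_nonneg hu0]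
    exact mul_le_mul_of_nonneg_left he hu0
  have ha4 : ‖a ⟨p.src, p.ν⟩‖ ≤ u * σ :=
    norm_hatSum_le_of_support ht w hw A _ fun e he => hAσ e (hσb e (Or.inr (Or.inr (Or.inr he))))
  -- a column site `y₀` (the column weights sum to one) ⇒ `0 ≤ Δ`, `0 ≤ F`, and the coarse reading there
  have hsum := sum_colW_eq_one ht p.src p.hμν.ne
  obtain ⟨y₀, -, hy₀⟩ := Finset.exists_ne_zero_of_sum_ne_zero (by rw [hsum]; exact one_ne_zero)
  obtain ⟨g1, -, -, g4, gF, gd1, gd4, gv3, gv2⟩ := hσy y₀ hy₀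
  have hΔ0 : 0 ≤ Δ := (norm_nonneg _).trans gd1
  have hσ0 : 0 ≤ σ := (norm_nonneg _).trans g1
  -- (1) the fine plaquette: two variations + base commutator, exactly
  have h1 : dist1 (GaugeField.plaqHol V p)
      ≤ ‖a ⟨p.src.shift p.μ, p.ν⟩ - a ⟨p.src, p.ν⟩‖ + ‖a ⟨p.src.shift p.ν, p.μ⟩ - a ⟨p.src, p.μ⟩‖
        + ‖imQuat (a ⟨p.src, p.μ⟩) * imQuat (a ⟨p.src, p.ν⟩) - imQuat (a ⟨p.src, p.ν⟩) * imQuat (a ⟨p.src, p.μ⟩)‖ := by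
    unfold GaugeField.plaqHol
    rw [hVa, hVa, hVa, hVa]
    exact dist1_plaq4_le_var_add_comm _ _ _ _
  -- (2) the two fine parallel variations: `L⁻² Δ`
  have h3μ : ‖a ⟨p.src.shift p.ν, p.μ⟩ - a ⟨p.src, p.μ⟩‖ ≤ u * (u * Δ) := by
    rw [norm_sub_rev]
    refine norm_sub_shift_hat_le ht w hw A a (fun _ => rfl) p.src p.hμν.ne' fun y hy => ?_
    obtain ⟨-, -, -, -, -, -, -, gv, -⟩ := hσy y hy
    rw [norm_sub_rev]
    exact hAΔ _ _ gv
  have h3ν : ‖a ⟨p.src.shift p.μ, p.ν⟩ - a ⟨p.src, p.ν⟩‖ ≤ u * (u * Δ) := by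
    rw [norm_sub_rev]
    refine norm_sub_shift_hat_le ht w hw A a (fun _ => rfl) p.src p.hμν.ne fun y hy => ?_
    rw [colW_swap p.src p.μ p.ν y] at hy
    obtain ⟨-, -, -, -, -, -, -, -, gv⟩ := hσy y hy
    rw [norm_sub_rev]
    exact hAΔ _ _ gv
  -- (3) the fine commutator vs `L⁻² [ιRμ, ιRν]`
  have eC : imQuat (u • Rμ) * imQuat (u • Rν) - imQuat (u • Rν) * imQuat (u • Rμ)
      = u ^ 2 • (imQuat Rμ * imQuat Rν - imQuat Rν * imQuat Rμ) := by
    rw [map_smul, map_smul, smul_mul_smul_comm, smul_mul_smul_comm, ← smul_sub, sq]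
  have h4a : ‖(imQuat (a ⟨p.src, p.μ⟩) * imQuat (a ⟨p.src, p.ν⟩) - imQuat (a ⟨p.src, p.ν⟩) * imQuat (a ⟨p.src, p.μ⟩))
      - u ^ 2 • (imQuat Rμ * imQuat Rν - imQuat Rν * imQuat Rμ)‖ ≤ 4 * (u * σ) * (u * Δ) := by
    rw [← eC]
    refine norm_comm_sub_comm_ref_le _ _ _ _ ?_ ?_ ha4 ?_
    · exact norm_hatSum_sub_le_of_support ht w hw A ⟨p.src, p.μ⟩ (u • Rμ) fun e he => hAΔ e Rμ (hΔμ e he)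
    · exact norm_hatSum_sub_le_of_support ht w hw A ⟨p.src, p.ν⟩ (u • Rν) fun e he => hAΔ e Rν (hΔν e he)
    · rw [norm_smul, Real.norm_eq_abs, abs_of_nonneg hu0]; exact mul_le_mul_of_nonneg_left hRμ hu0
  -- (4) the reference commutator vs the base commutator of the column plaquette at `y₀`, and that one by the chord (§2)
  have h4b : ‖imQuat Rμ * imQuat Rν - imQuat Rν * imQuat Rμ‖ ≤ π ^ 2 / 4 * (F + 2 * Δ) + 4 * σ * Δ := by
    have hB := norm_comm_logVec_le_of_plaqHol (X ⟨y₀, p.μ⟩) (X ⟨y₀.shift p.μ, p.ν⟩) (X ⟨y₀.shift p.ν, p.μ⟩) (X ⟨y₀, p.ν⟩)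
      (g1.trans hσ2) (g4.trans hσ2)
    have hBF : dist1 (X ⟨y₀, p.μ⟩ * X ⟨y₀.shift p.μ, p.ν⟩ * (X ⟨y₀.shift p.ν, p.μ⟩)⁻¹ * (X ⟨y₀, p.ν⟩)⁻¹) ≤ F := gF
    have hC := norm_comm_sub_comm_ref_le (logVec (su2Quat (X ⟨y₀, p.μ⟩))) (logVec (su2Quat (X ⟨y₀, p.ν⟩))) Rμ Rν gd1 gd4 g4 hRμ
    have hπ0 : 0 ≤ (π / 2) ^ 2 := sq_nonneg _
    have hB' : ‖imQuat (logVec (su2Quat (X ⟨y₀, p.μ⟩))) * imQuat (logVec (su2Quat (X ⟨y₀, p.ν⟩)))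
        - imQuat (logVec (su2Quat (X ⟨y₀, p.ν⟩))) * imQuat (logVec (su2Quat (X ⟨y₀, p.μ⟩)))‖ ≤ (π / 2) ^ 2 * (F + 2 * Δ) := by
      exact hB.trans (mul_le_mul_of_nonneg_left (by linarith) hπ0)
    have e4 : (π / 2) ^ 2 = π ^ 2 / 4 := by ring
    rw [e4] at hB'
    calc ‖imQuat Rμ * imQuat Rν - imQuat Rν * imQuat Rμ‖
        = ‖(imQuat (logVec (su2Quat (X ⟨y₀, p.μ⟩))) * imQuat (logVec (su2Quat (X ⟨y₀, p.ν⟩)))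
            - imQuat (logVec (su2Quat (X ⟨y₀, p.ν⟩))) * imQuat (logVec (su2Quat (X ⟨y₀, p.μ⟩))))
          - ((imQuat (logVec (su2Quat (X ⟨y₀, p.μ⟩))) * imQuat (logVec (su2Quat (X ⟨y₀, p.ν⟩)))
            - imQuat (logVec (su2Quat (X ⟨y₀, p.ν⟩))) * imQuat (logVec (su2Quat (X ⟨y₀, p.μ⟩))))
            - (imQuat Rμ * imQuat Rν - imQuat Rν * imQuat Rμ))‖ := by rw [sub_sub_cancel]
      _ ≤ _ := norm_sub_le _ _
      _ ≤ (π ^ 2 / 4 * (F + 2 * Δ)) + 4 * σ * Δ := add_le_add hB' hC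
  -- (5) assemble
  have h4 : ‖imQuat (a ⟨p.src, p.μ⟩) * imQuat (a ⟨p.src, p.ν⟩) - imQuat (a ⟨p.src, p.ν⟩) * imQuat (a ⟨p.src, p.μ⟩)‖
      ≤ u ^ 2 * (π ^ 2 / 4 * (F + 2 * Δ) + 4 * σ * Δ) + 4 * (u * σ) * (u * Δ) := by
    have hn : ‖u ^ 2 • (imQuat Rμ * imQuat Rν - imQuat Rν * imQuat Rμ)‖ ≤ u ^ 2 * (π ^ 2 / 4 * (F + 2 * Δ) + 4 * σ * Δ) := by
      rw [norm_smul, Real.norm_eq_abs, abs_of_nonneg (sq_nonneg u)]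
      exact mul_le_mul_of_nonneg_left h4b (sq_nonneg u)
    calc ‖imQuat (a ⟨p.src, p.μ⟩) * imQuat (a ⟨p.src, p.ν⟩) - imQuat (a ⟨p.src, p.ν⟩) * imQuat (a ⟨p.src, p.μ⟩)‖
        = ‖u ^ 2 • (imQuat Rμ * imQuat Rν - imQuat Rν * imQuat Rμ)
            + ((imQuat (a ⟨p.src, p.μ⟩) * imQuat (a ⟨p.src, p.ν⟩) - imQuat (a ⟨p.src, p.ν⟩) * imQuat (a ⟨p.src, p.μ⟩))
              - u ^ 2 • (imQuat Rμ * imQuat Rν - imQuat Rν * imQuat Rμ))‖ := by rw [add_sub_cancel]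
      _ ≤ _ := norm_add_le_of_le hn h4a
  have hcomm : 4 * (u * σ) * (u * Δ) = u ^ 2 * (4 * σ * Δ) := by ring
  rw [hcomm] at h4
  have htot := h1.trans (add_le_add (add_le_add h3ν h3μ) h4)
  refine htot.trans (le_of_eq ?_)
  rw [hu]; ring

/-! ## §4 The global two-profile docking form at `d = 3` -/

/-- ★★★ **THE ALL-ORDERS REFINED (F3) LETTER, GLOBAL FORM AT `d = 3`**: if every coarse bond has arc `≤ s ≤ π∕2`, every coarse plaquette chord `dist1 ≤ F`, and every ADJACENT
TRANSVERSE parallel variation `‖log X⟨y + e_ι, κ⟩ − log X⟨y, κ⟩‖ ≤ v` (`ι ≠ κ`), then every fine plaquette of the hat lift has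
    `dist1 (V(∂p)) ≤ (L⁻¹)² · (π²∕4·(F + 4v) + 4v + 16·s·v)`
(§3 with `Rμ, Rν` the base-corner logs of a column plaquette and `Δ = 2v` by ✓p827730's support geometry, VERBATIM) — the drop-in replacement of
✓`dist1_plaqHol_lift_le_second_of_forall` (`(L⁻¹)²·(F + (F + 12s²)² + 40sv + 8v² + 35s³)`, `s ≤ 1∕4`): no pure-size term, no chart guard. [cite: Balaban1985RegularSpaces, (1.29) p.81] -/
theorem dist1_plaqHol_lift_le_allOrders_of_forall (hd : P.d = 3) (ht : t + 1 ≤ P.m + P.K) (w : PBond P t → PBond P (t + 1) → ℝ)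
    (hw : ∀ b e, w b e = if e.dir = b.dir ∧ (b.src b.dir - emb e.src b.dir).val < P.L then
      ∏ ν ∈ Finset.univ.erase b.dir, max 0 (1 - ((rel (emb e.src) b.src ν).natAbs : ℝ) / P.L) else 0)
    (X : GaugeField P (t + 1) SU2) (V : GaugeField P t SU2)
    (hV : ∀ b, V b = expPoint (∑ e, w b e • ((P.L : ℝ)⁻¹ • logVec (su2Quat (X e))))) {s F v : ℝ}
    (hs : ∀ e, ‖logVec (su2Quat (X e))‖ ≤ s) (hs2 : s ≤ π / 2) (hF : ∀ q : Plaq P (t + 1), dist1 (GaugeField.plaqHol X q) ≤ F)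
    (hv : ∀ (y : Site P (t + 1)) (ι κ : Fin P.d), ι ≠ κ →
      ‖logVec (su2Quat (X ⟨y.shift ι, κ⟩)) - logVec (su2Quat (X ⟨y, κ⟩))‖ ≤ v)
    (p : Plaq P t) :
    dist1 (GaugeField.plaqHol V p) ≤ ((P.L : ℝ)⁻¹) ^ 2 * (π ^ 2 / 4 * (F + 4 * v) + 4 * v + 16 * s * v) := by
  classical
  -- a column site `y₀` (the column weights sum to one) and its window
  have hsum := sum_colW_eq_one ht p.src p.hμν.ne
  obtain ⟨y₀, -, hy₀⟩ := Finset.exists_ne_zero_of_sum_ne_zero (by rw [hsum]; exact one_ne_zero)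
  have hv0 : 0 ≤ v := (norm_nonneg _).trans (hv y₀ p.μ p.ν p.hμν.ne)
  obtain ⟨⟨g0μ, gLμ⟩, ⟨g0ν, gLν⟩, gκ⟩ := colW_support ht hy₀
  have natAbs_lt_of : ∀ {r : ℤ}, 0 ≤ r → r < P.L → r.natAbs < P.L := fun h0 hL => by
    have := Int.natAbs_lt_natAbs_of_nonneg_of_lt h0 hL
    simpa using this
  have h2v : v ≤ 2 * v := by linarith
  -- the support-local letter with the base-corner logs of `y₀` as references and `Δ := 2v`
  have key := dist1_plaqHol_lift_le_allOrders ht w hw X V hV p (σ := s) (F := F) (Δ := 2 * v)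
    (logVec (su2Quat (X ⟨y₀, p.μ⟩))) (logVec (su2Quat (X ⟨y₀, p.ν⟩))) hs2 (hs _) (fun e _ => hs e) ?_ ?_ ?_
  · refine key.trans (le_of_eq ?_); ring
  · -- `hΔμ`: the `μ`-logs feeding `a⟨x, μ⟩`
    intro e he
    obtain ⟨hdir, ⟨h0, hL'⟩, hoth⟩ := hatW_support ht w hw he
    obtain ⟨y, dir⟩ := e
    change dir = p.μ at hdir
    subst hdir
    refine norm_sub_le_two_mul_of_near hd (fun e => logVec (su2Quat (X e))) hv0 hv p.μ y y₀
      (coord_eq_of_rel_slab ht p.src y₀ y p.μ g0μ gLμ h0 hL') fun κ hκ => ?_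
    have hy0κ : (rel (emb y₀) p.src κ).natAbs < P.L := by
      by_cases hκν : κ = p.ν
      · rw [hκν]; exact natAbs_lt_of g0ν gLν
      · exact gκ κ hκ hκν
    exact coord_near_of_rel_lt ht p.src y₀ y κ hy0κ (hoth κ hκ)
  · -- `hΔν`: the `ν`-logs feeding `a⟨x, ν⟩`
    intro e he
    obtain ⟨hdir, ⟨h0, hL'⟩, hoth⟩ := hatW_support ht w hw he
    obtain ⟨y, dir⟩ := e
    change dir = p.ν at hdir
    subst hdir
    refine norm_sub_le_two_mul_of_near hd (fun e => logVec (su2Quat (X e))) hv0 hv p.ν y y₀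
      (coord_eq_of_rel_slab ht p.src y₀ y p.ν g0ν gLν h0 hL') fun κ hκ => ?_
    have hy0κ : (rel (emb y₀) p.src κ).natAbs < P.L := by
      by_cases hκμ : κ = p.μ
      · rw [hκμ]; exact natAbs_lt_of g0μ gLμ
      · exact gκ κ hκμ hκ
    exact coord_near_of_rel_lt ht p.src y₀ y κ hy0κ (hoth κ hκ)
  · -- `hσy`: the column sites
    intro y hy
    obtain ⟨⟨q0μ, qLμ⟩, ⟨q0ν, qLν⟩, qκ⟩ := colW_support ht hy
    refine ⟨hs _, hs _, hs _, hs _, hF ⟨y, p.μ, p.ν, p.hμν⟩, ?_, ?_, (hv y p.ν p.μ p.hμν.ne').trans h2v, (hv y p.μ p.ν p.hμν.ne).trans h2v⟩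
    · refine norm_sub_le_two_mul_of_near hd (fun e => logVec (su2Quat (X e))) hv0 hv p.μ y y₀
        (coord_eq_of_rel_slab ht p.src y₀ y p.μ g0μ gLμ q0μ qLμ) fun κ hκ => ?_
      by_cases hκν : κ = p.ν
      · rw [hκν]; exact Or.inl (coord_eq_of_rel_slab ht p.src y₀ y p.ν g0ν gLν q0ν qLν)
      · exact coord_near_of_rel_lt ht p.src y₀ y κ (gκ κ hκ hκν) (qκ κ hκ hκν)
    · refine norm_sub_le_two_mul_of_near hd (fun e => logVec (su2Quat (X e))) hv0 hv p.ν y y₀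
        (coord_eq_of_rel_slab ht p.src y₀ y p.ν g0ν gLν q0ν qLν) fun κ hκ => ?_
      by_cases hκμ : κ = p.μ
      · rw [hκμ]; exact Or.inl (coord_eq_of_rel_slab ht p.src y₀ y p.μ g0μ gLμ q0μ qLμ)
      · exact coord_near_of_rel_lt ht p.src y₀ y κ (gκ κ hκμ hκ) (qκ κ hκμ hκ)

end Summit.QuantumFields.YangMills.Theorems.FluctuationComparisonRegPrIntLS2BetaWhitneyHatLiftCurvatureAllOrders
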